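import Literature.AnabelianGeometry.AbsoluteAnabelian.FreeProfiniteSurfaceRelatorCusp
import Literature.AnabelianGeometry.AbsoluteAnabelian.AbsTopISemiAbsolute
import Literature.AnabelianGeometry.AbsoluteAnabelian.FreeProcyclicModel
import Literature.AnabelianGeometry.AbsoluteAnabelian.AbsTopIII.CurveModelProp14iiReduction
import Literature.AnabelianGeometry.AbsoluteAnabelian.AbsTopIII.CuspidalCyclotome
import HarnessLib

/-!
# [AbsTopIII] Prop. 1.4 (ii) at an ARBITRARY model from the Heisenberg law on `Δ_{U_x}` (FACT-LIST F-0341, law-closer)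

Mochizuki, *Topics in Absolute Anabelian Geometry III*, §1, Prop. 1.4 (ii), manuscript p. 31 (lit key
`paper:url-5493eb38cbb7`): "we have a natural exact sequence of profinite groups
`1 → I_x → Δ^{c-cn}_{U_x} → Δ_X → 1`".  The tree records this display RELATIVE TO A MODEL `M : CurveModel`
as the named fact `CurveModel.Prop_1_4_ii M` (F-0341; universal closure REFUTED at junk models,
`CurveModel.not_forall_prop_1_4_ii`; instances at the once-punctured torus / closed surface of genus `g`,
`CurveModel.exists_oncePuncturedTorus_prop_1_4`, `CurveModel.exists_closedSurface_prop_1_4`), and abc-iut's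
reduction `CurveModel.prop_1_4_ii_iff_inf_eq_bot` shows that its content is exactly the injectivity clause
`I_x ∩ [N, Δ_{U_x}]⁻ = 1`, `N := Ker(Π_{U_x} ↠ Π_X) ∩ Δ_{U_x} = ⟨⟨I_x⟩⟩⁻`.

This PROOF-ONLY file (no definitions, no named facts) closes F-0341 at EVERY model — arbitrary base field
`k`, arbitrary `G_k` — from a law on the GEOMETRIC fundamental group `Δ_{U_x}` alone, in two strengths:

* **(HZ) Heisenberg law** (`CurveModel.prop_1_4_ii_of_centralImagesLaw`): at every presentation
  `(U_x ⊆ X, x)` in the scope of (ii), `I_x = ⟨c⟩⁻` for some `c ∈ Δ_{U_x}` having CENTRAL IMAGES OF EVERY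
  ORDER — for each `m ≥ 1` a continuous homomorphism of `Δ_{U_x}` to a finite group carrying `c` to a
  central element of order `m`.  For the étale `π₁` this is the Heisenberg quotient `H(ℤ/m)` of the
  surface group (`a_0 ↦ x`, `b_0 ↦ y`, `∏[a_i, b_i] ↦ [x, y]`).  The law is on `Δ`, not on `Π`: in a finite
  quotient of `Π_{U_x}` in which the image of `c` is central, the cyclotomic twist `σ c σ⁻¹ = c^{χ(σ)}`
  (`σ ∈ G_k`) forces `c^{χ(σ) - 1} ↦ 1`, which bounds the order of the image when `k` has finitely many
  roots of unity.
* **(SP) surface-presentation law** (`CurveModel.prop_1_4_ii_of_surfacePresentationLaw`): at every such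
  presentation `Δ_{U_x}` is free profinite on `a_i, b_i` (`i < g_X`, abc-iut-L4-t4's `IsFreeProOn`) with
  `I_x = ⟨∏_{i<g_X} [a_i, b_i]⟩⁻` — the classical structure of `π₁` of a once-punctured proper curve of
  genus `g_X` over an algebraically closed field of characteristic zero [SGA1 XIII Cor. 2.12 + the
  presentation of surface groups]; (SP) ⇒ (HZ) by abc-iut-L4-t17's
  `IsFreeProOn.centralImages_surfaceRelator` (genus `0` is handled separately: then `I_x = 1`).

The group theory is abc-iut-L4-t17's `topologicalClosure_zpowers_inf_eq_bot_of_centralImages`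
(`⟨c⟩⁻ ∩ [⟨⟨c⟩⟩⁻_Δ, Δ]⁻ = 1` inside `Δ`); the NEW glue (§1) moves it from `Δ` into `Π`: for a RATIONAL cusp
`x` (`D_x ↠ G`) every `Π`-conjugate of an element of `I_x` is a `Δ`-conjugate of an element of `I_x`
(`g = δ d`, `d ∈ D_x`, `d I_x d⁻¹ = I_x`), so the `Π`-normal closure `N` of `I_x` is generated by
`Δ`-conjugates and `[N, Δ]⁻` is computed inside `Δ` (`normalClosure_Icusp_le_map_of_isRational`,
`inf_cuspidallyCentralModulus_eq_bot_of_centralImages`, `isCuspidallyCentralExtension_of_centralImages`).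
§3 (v2 addendum): the same datum gives `I_x ≅ Ẑ` (`isFreeProcyclic_Icusp_of_imagesOfEveryOrder`) and hence a
full `IsCyclotomePresentation` (`CurveModel.isCyclotomePresentation_of_centralImages` /
`_of_surfacePresentation`) — the hypothesis container of the Thm. 1.9 (b)/(e) and Prop. 1.6 consumers.
NON-VACUITY (a model with a genuine hyperbolic (ii)-scope — genus `g ≥ 1`, `X` proper, `x` rational,
`N = ⟨⟨I_x⟩⟩⁻`, `I_x ≠ 1`, `Δ_X ≠ 1` — at which BOTH laws hold and the closers fire) and the PACKAGE
"(SP) + F-0340 ⇒ F-0341 ∧ F-0338 ∧ F-0365" are the companion PROOF-ONLY file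
`CurveModelProp14iiLawsPackage.lean` (`CurveModel.exists_model_surfacePresentationLaw`,
`CurveModel.prop_1_4_ii_rows_of_surfacePresentationLaw`).

HONEST LABEL: the laws are hypothesis BINDERS (interface laws on the model, true for the étale `π₁` by
Riemann's existence theorem — not constructed in the tree); a law-closer is OUR kernel reduction of the typed
row to that classical input, not the printed theorem.  Nothing here bears on [IUTchIII] Cor. 3.12; typed ≠ proved.
-/

noncomputable section

open CategoryTheory Topology
open scoped Pointwise

universe u

namespace Literature.AnabelianGeometry.AbsoluteAnabelian

/-! ### §1 One presentation: from `Δ` into `Π` -/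

/-- Topological closure commutes with the closed embedding `Δ ↪ Π`: for a subgroup `H ⊆ Δ`,
`(H)⁻_Π = (H⁻_Δ)` as subgroups of `Π`. [folklore] -/
private theorem FundamentalExtension.topologicalClosure_map_geomSubtype (E : FundamentalExtension.{u})
    (H : Subgroup E.geom) :
    (H.map E.geom.subtype).topologicalClosure = H.topologicalClosure.map E.geom.subtype := by
  apply SetLike.coe_injective
  rw [Subgroup.topologicalClosure_coe, Subgroup.coe_map, Subgroup.coe_map,
    Subgroup.topologicalClosure_coe, Subgroup.coe_subtype]
  exact E.isClosed_geom.isClosedEmbedding_subtypeVal.closure_image_eq _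

/-- Two subgroups of `Π` contained in the images of subgroups `A', B' ⊆ Δ` with `A' ∩ B' = 1` meet
trivially. [folklore] -/
private theorem FundamentalExtension.inf_eq_bot_of_le_map_geomSubtype (E : FundamentalExtension.{u})
    {A B : Subgroup E.arith} {A' B' : Subgroup E.geom} (hA : A ≤ A'.map E.geom.subtype)
    (hB : B ≤ B'.map E.geom.subtype) (h : A' ⊓ B' = ⊥) : A ⊓ B = ⊥ := by
  rw [eq_bot_iff, ← Subgroup.map_bot E.geom.subtype, ← h,
    Subgroup.map_inf_eq _ _ _ E.geom.subtype_injective]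
  exact inf_le_inf hA hB

namespace AbsTopIII

variable {E F : FundamentalExtension.{u}} (q : E ⟶ F) (C : E.CuspidalData) (x : C.Cusp)

/-- **For a RATIONAL cusp the `Π`-normal closure of `I_x` is generated by `Δ`-conjugates.**  If
`D_x ↠ G` and `I_x` is the image of `I' ⊆ Δ`, then every `Π`-conjugate `g i g⁻¹` (`i ∈ I_x`) is
`δ (d i d⁻¹) δ⁻¹` with `g = δ d`, `δ ∈ Δ`, `d ∈ D_x`, `d i d⁻¹ ∈ D_x ∩ Δ = I_x`; hence
`⟨⟨I_x⟩⟩_Π ≤ ⟨⟨I'⟩⟩_Δ` (as subgroups of `Π`). [cite: MochizukiAbsTopIII2015, Prop 1.4 (ii) p.31] -/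
theorem normalClosure_Icusp_le_map_of_isRational (hx : C.IsRational x) (I' : Subgroup E.geom)
    (hI' : C.Icusp x = I'.map E.geom.subtype) :
    Subgroup.normalClosure (C.Icusp x : Set E.arith) ≤
      (Subgroup.normalClosure (I' : Set E.geom)).map E.geom.subtype := by
  change Subgroup.closure _ ≤ _
  rw [Subgroup.closure_le]
  intro y hy
  obtain ⟨a, ha, hay⟩ := Group.mem_conjugatesOfSet_iff.mp hy
  obtain ⟨g, rfl⟩ := isConj_iff.mp hay
  obtain ⟨d, hd, hdg⟩ := hx (Set.mem_univ (E.aug g))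
  have hδ : g * d⁻¹ ∈ E.geom := by
    rw [FundamentalExtension.mem_geom, map_mul, map_inv, hdg, mul_inv_cancel]
  have hjD : d * a * d⁻¹ ∈ C.Dcusp x :=
    (C.Dcusp x).mul_mem ((C.Dcusp x).mul_mem hd (C.Icusp_le_Dcusp x ha)) ((C.Dcusp x).inv_mem hd)
  have hjΔ : d * a * d⁻¹ ∈ E.geom := E.normal_geom.conj_mem a (C.Icusp_le_geom x ha) d
  have hj : d * a * d⁻¹ ∈ C.Icusp x := by
    rw [C.Icusp_eq x]
    exact ⟨hjD, hjΔ⟩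
  rw [hI'] at hj
  obtain ⟨j', hj', hj'eq⟩ := Subgroup.mem_map.mp hj
  refine Subgroup.mem_map.mpr ⟨⟨g * d⁻¹, hδ⟩ * j' * ⟨g * d⁻¹, hδ⟩⁻¹, ?_, ?_⟩
  · exact Subgroup.conjugatesOfSet_subset_normalClosure
      (Group.mem_conjugatesOfSet_iff.mpr ⟨j', hj', isConj_iff.mpr ⟨⟨g * d⁻¹, hδ⟩, rfl⟩⟩)
  · rw [map_mul, map_mul, map_inv, hj'eq, Subgroup.coe_subtype]
    group

/-- **`I_x ∩ [N, Δ]⁻ = 1` from central images (one presentation).**  Let `q : Π_{U_x} → Π_X` be a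
homomorphism of extensions, `x` a RATIONAL cusp with `N := Ker(q) ∩ Δ = ⟨⟨I_x⟩⟩⁻`, and suppose
`I_x = ⟨c⟩⁻` for some `c ∈ Δ` having central images of every order in finite continuous quotients of
`Δ`.  Then `I_x ∩ [N, Δ]⁻ = 1` — abc-iut-L4-t17's `⟨c⟩⁻ ∩ [⟨⟨c⟩⟩⁻_Δ, Δ]⁻ = 1` inside `Δ`, pushed into
`Π` along the closed embedding `Δ ↪ Π` (rationality makes the `Π`-normal closure a `Δ`-normal closure).
[cite: MochizukiAbsTopIII2015, Prop 1.4 (ii) p.31] -/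
theorem inf_cuspidallyCentralModulus_eq_bot_of_centralImages (hx : C.IsRational x)
    (hker : cuspidalKernel q =
      (Subgroup.normalClosure (C.Icusp x : Set E.arith)).topologicalClosure)
    (c : E.geom) (hI : C.Icusp x = (Subgroup.zpowers (c : E.arith)).topologicalClosure)
    (hc : ∀ m : ℕ, 0 < m → ∃ (K : Type) (_ : Group K) (_ : Finite K) (_ : TopologicalSpace K)
      (_ : DiscreteTopology K) (ψ : E.geom →* K),
        Continuous ψ ∧ ψ c ∈ Subgroup.center K ∧ orderOf (ψ c) = m) :
    C.Icusp x ⊓ cuspidallyCentralModulus q = ⊥ := by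
  have hI' : C.Icusp x = (Subgroup.zpowers c).topologicalClosure.map E.geom.subtype := by
    rw [hI, ← E.topologicalClosure_map_geomSubtype, MonoidHom.map_zpowers, Subgroup.coe_subtype]
  have hN : cuspidalKernel q ≤
      (Subgroup.normalClosure
        ((Subgroup.zpowers c).topologicalClosure : Set E.geom)).topologicalClosure.map E.geom.subtype := by
    rw [hker, ← E.topologicalClosure_map_geomSubtype]
    exact Subgroup.topologicalClosure_mono (normalClosure_Icusp_le_map_of_isRational C x hx _ hI')
  have hgeom : E.geom = (⊤ : Subgroup E.geom).map E.geom.subtype := by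
    rw [← MonoidHom.range_eq_map, Subgroup.range_subtype]
  have hJ : cuspidallyCentralModulus q ≤
      (⁅(Subgroup.normalClosure
          ((Subgroup.zpowers c).topologicalClosure : Set E.geom)).topologicalClosure,
        (⊤ : Subgroup E.geom)⁆).topologicalClosure.map E.geom.subtype := by
    unfold cuspidallyCentralModulus
    rw [← E.topologicalClosure_map_geomSubtype, Subgroup.map_commutator, ← hgeom]
    exact Subgroup.topologicalClosure_mono (Subgroup.commutator_mono hN le_rfl)
  haveI : CompactSpace E.geom := isCompact_iff_compactSpace.mp E.isClosed_geom.isCompact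
  exact E.inf_eq_bot_of_le_map_geomSubtype hI'.le hJ
    (topologicalClosure_zpowers_inf_eq_bot_of_centralImages c hc)

/-- Hence, under the same hypotheses, **`1 → I_x → Δ^{c-cn}_{U_x} → Δ_X → 1` is exact**
(`IsCuspidallyCentralExtension q I_x`): the exactness clause is automatic for rational cusps
(`isCuspidallyCentralExtension_iff_inf_eq_bot`). [cite: MochizukiAbsTopIII2015, Prop 1.4 (ii) p.31] -/
theorem isCuspidallyCentralExtension_of_centralImages (hx : C.IsRational x)
    (hker : cuspidalKernel q =
      (Subgroup.normalClosure (C.Icusp x : Set E.arith)).topologicalClosure)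
    (c : E.geom) (hI : C.Icusp x = (Subgroup.zpowers (c : E.arith)).topologicalClosure)
    (hc : ∀ m : ℕ, 0 < m → ∃ (K : Type) (_ : Group K) (_ : Finite K) (_ : TopologicalSpace K)
      (_ : DiscreteTopology K) (ψ : E.geom →* K),
        Continuous ψ ∧ ψ c ∈ Subgroup.center K ∧ orderOf (ψ c) = m) :
    IsCuspidallyCentralExtension q (C.Icusp x) :=
  (isCuspidallyCentralExtension_iff_inf_eq_bot q C x hx hker).mpr
    (inf_cuspidallyCentralModulus_eq_bot_of_centralImages q C x hx hker c hI hc)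

/-! ### §2 The law-closers at an arbitrary model -/

/-- **F-0341 from the Heisenberg law (HZ).**  If at every presentation `(U_x ⊆ X, x)` in the scope of
Prop. 1.4 (ii) (`U_x, X` scheme-like, `X` proper, `x` rational, `N = ⟨⟨I_x⟩⟩⁻`) the inertia group is
`I_x = ⟨c⟩⁻` for some `c ∈ Δ_{U_x}` with central images of every order in finite continuous quotients of
`Δ_{U_x}` (étale `π₁`: the Heisenberg quotients `H(ℤ/m)`), then `M.Prop_1_4_ii` — at an ARBITRARY model,
any base field.  Law = hypothesis binder, not a new fact. [cite: MochizukiAbsTopIII2015, Prop 1.4 (ii) p.31] -/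
theorem CurveModel.prop_1_4_ii_of_centralImagesLaw (M : CurveModel.{u})
    (hHZ : ∀ (Ux X : M.Curve) (h : M.IsCofiniteOpen Ux X), M.IsScheme Ux → M.IsScheme X →
      M.IsProper X → ∀ x : (M.cusps Ux).Cusp, (M.cusps Ux).IsRational x →
        cuspidalKernel (M.res h) =
          (Subgroup.normalClosure ((M.cusps Ux).Icusp x : Set (M.ext Ux).arith)).topologicalClosure →
        ∃ c : (M.ext Ux).geom,
          (M.cusps Ux).Icusp x = (Subgroup.zpowers (c : (M.ext Ux).arith)).topologicalClosure ∧
          ∀ m : ℕ, 0 < m → ∃ (K : Type) (_ : Group K) (_ : Finite K) (_ : TopologicalSpace K)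
            (_ : DiscreteTopology K) (ψ : (M.ext Ux).geom →* K),
              Continuous ψ ∧ ψ c ∈ Subgroup.center K ∧ orderOf (ψ c) = m) :
    M.Prop_1_4_ii := by
  rw [CurveModel.prop_1_4_ii_iff_inf_eq_bot]
  intro Ux X h hUx hX hXp x hx hker
  obtain ⟨c, hI, hc⟩ := hHZ Ux X h hUx hX hXp x hx hker
  exact inf_cuspidallyCentralModulus_eq_bot_of_centralImages (M.res h) (M.cusps Ux) x hx hker c hI hc

/-- **F-0341 from the surface-presentation law (SP).**  If at every presentation `(U_x ⊆ X, x)` in the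
scope of Prop. 1.4 (ii) the geometric fundamental group `Δ_{U_x}` is free profinite on generators
`a_i := gens (castAdd g i)`, `b_i := gens (natAdd g i)` (`i < g := genus X`) with
`I_x = ⟨∏_{i<g} [a_i, b_i]⟩⁻` — the structure of `π₁` of a once-punctured proper curve of genus `g`
[SGA1 XIII Cor. 2.12 + the presentation of surface groups] — then `M.Prop_1_4_ii`, at an ARBITRARY model.
Genus `0`: `I_x = 1`; genus `≥ 1`: (SP) ⇒ (HZ) by `IsFreeProOn.centralImages_surfaceRelator`.
Law = hypothesis binder, not a new fact. [cite: MochizukiAbsTopIII2015, Prop 1.4 (ii) p.31] -/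
theorem CurveModel.prop_1_4_ii_of_surfacePresentationLaw (M : CurveModel.{u})
    (hSP : ∀ (Ux X : M.Curve) (h : M.IsCofiniteOpen Ux X), M.IsScheme Ux → M.IsScheme X →
      M.IsProper X → ∀ x : (M.cusps Ux).Cusp, (M.cusps Ux).IsRational x →
        cuspidalKernel (M.res h) =
          (Subgroup.normalClosure ((M.cusps Ux).Icusp x : Set (M.ext Ux).arith)).topologicalClosure →
        ∃ gens : Fin (M.genus X + M.genus X) → (M.ext Ux).geom,
          IsFreeProOn (M.ext Ux).geom {p : ℕ | p.Prime} gens ∧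
          (M.cusps Ux).Icusp x =
            (Subgroup.zpowers ((((List.finRange (M.genus X)).map fun i =>
              gens (Fin.castAdd (M.genus X) i) * gens (Fin.natAdd (M.genus X) i) *
                (gens (Fin.castAdd (M.genus X) i))⁻¹ * (gens (Fin.natAdd (M.genus X) i))⁻¹).prod :
                  (M.ext Ux).geom) : (M.ext Ux).arith)).topologicalClosure) :
    M.Prop_1_4_ii := by
  rw [CurveModel.prop_1_4_ii_iff_inf_eq_bot]
  intro Ux X h hUx hX hXp x hx hker
  obtain ⟨gens, hP, hI⟩ := hSP Ux X h hUx hX hXp x hx hker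
  have hS : ∀ p : ℕ, p.Prime → p ∈ {p : ℕ | p.Prime} := fun p hp => hp
  rcases Nat.eq_zero_or_pos (M.genus X) with h0 | hpos
  · -- genus `0`: the relator is the empty product, `I_x = ⟨1⟩⁻ = 1`
    have hnil : List.finRange (M.genus X) = [] :=
      List.eq_nil_of_length_eq_zero (by rw [List.length_finRange, h0])
    rw [hnil, List.map_nil, List.prod_nil, OneMemClass.coe_one, Subgroup.zpowers_one_eq_bot] at hI
    rw [eq_bot_iff, hI]
    rintro y ⟨hy, -⟩
    have hy' : y ∈ closure ({1} : Set (M.ext Ux).arith) := by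
      rw [← Subgroup.coe_topologicalClosure_bot]
      exact hy
    rw [closure_singleton, Set.mem_singleton_iff] at hy'
    rw [hy']
    exact (⊥ : Subgroup (M.ext Ux).arith).one_mem
  · exact inf_cuspidallyCentralModulus_eq_bot_of_centralImages (M.res h) (M.cusps Ux) x hx hker _ hI
      (hP.centralImages_surfaceRelator hS hpos)

/-- **(SP) ⇒ (HZ) when every proper curve of the model has positive genus**: the surface relator
`∏_{i<g} [a_i, b_i]` of a free profinite group on the `a_i, b_i` (`g ≥ 1`) has central images of every
order (abc-iut-L4-t17's Heisenberg-group homomorphisms `IsFreeProOn.centralImages_surfaceRelator`).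
[cite: MochizukiAbsTopIII2015, Prop 1.4 (ii) p.31] -/
theorem CurveModel.centralImagesLaw_of_surfacePresentationLaw (M : CurveModel.{u})
    (hSP : ∀ (Ux X : M.Curve) (h : M.IsCofiniteOpen Ux X), M.IsScheme Ux → M.IsScheme X →
      M.IsProper X → ∀ x : (M.cusps Ux).Cusp, (M.cusps Ux).IsRational x →
        cuspidalKernel (M.res h) =
          (Subgroup.normalClosure ((M.cusps Ux).Icusp x : Set (M.ext Ux).arith)).topologicalClosure →
        ∃ gens : Fin (M.genus X + M.genus X) → (M.ext Ux).geom,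
          IsFreeProOn (M.ext Ux).geom {p : ℕ | p.Prime} gens ∧
          (M.cusps Ux).Icusp x =
            (Subgroup.zpowers ((((List.finRange (M.genus X)).map fun i =>
              gens (Fin.castAdd (M.genus X) i) * gens (Fin.natAdd (M.genus X) i) *
                (gens (Fin.castAdd (M.genus X) i))⁻¹ * (gens (Fin.natAdd (M.genus X) i))⁻¹).prod :
                  (M.ext Ux).geom) : (M.ext Ux).arith)).topologicalClosure)
    (hpos : ∀ X : M.Curve, M.IsProper X → 0 < M.genus X) :
    ∀ (Ux X : M.Curve) (h : M.IsCofiniteOpen Ux X), M.IsScheme Ux → M.IsScheme X →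
      M.IsProper X → ∀ x : (M.cusps Ux).Cusp, (M.cusps Ux).IsRational x →
        cuspidalKernel (M.res h) =
          (Subgroup.normalClosure ((M.cusps Ux).Icusp x : Set (M.ext Ux).arith)).topologicalClosure →
        ∃ c : (M.ext Ux).geom,
          (M.cusps Ux).Icusp x = (Subgroup.zpowers (c : (M.ext Ux).arith)).topologicalClosure ∧
          ∀ m : ℕ, 0 < m → ∃ (K : Type) (_ : Group K) (_ : Finite K) (_ : TopologicalSpace K)
            (_ : DiscreteTopology K) (ψ : (M.ext Ux).geom →* K),
              Continuous ψ ∧ ψ c ∈ Subgroup.center K ∧ orderOf (ψ c) = m := by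
  intro Ux X h hUx hX hXp x hx hker
  obtain ⟨gens, hP, hI⟩ := hSP Ux X h hUx hX hXp x hx hker
  exact ⟨_, hI, hP.centralImages_surfaceRelator (fun p hp => hp) (hpos X hXp)⟩

/-! ### §3 (v2 addendum) The Heisenberg datum also gives `I_x ≅ Ẑ` and a cyclotome presentation -/

/-- **`I_x ≅ Ẑ` from images of every order.**  If `I_x = ⟨c⟩⁻` with `c ∈ Δ` having images of every
order `m` under continuous homomorphisms of `Δ` to finite groups (centrality not needed), then `I_x` is
free procyclic — abc-iut-L4-t17's `isFreeProcyclic_topologicalClosure_zpowers_of_centralImages` in `Δ`,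
transported along `⟨c⟩⁻_Δ ≃ₜ* I_x` (the closed embedding `Δ ↪ Π`): the group-theoretic content of
Prop. 1.4 (i) "`I_x` [...] is naturally isomorphic to `Ẑ(1)`" at such a cusp.
[cite: MochizukiAbsTopIII2015, Prop 1.4 (i) p.31] -/
theorem isFreeProcyclic_Icusp_of_imagesOfEveryOrder (c : E.geom)
    (hI : C.Icusp x = (Subgroup.zpowers (c : E.arith)).topologicalClosure)
    (hc : ∀ m : ℕ, 0 < m → ∃ (K : Type) (_ : Group K) (_ : Finite K) (_ : TopologicalSpace K)
      (_ : DiscreteTopology K) (ψ : E.geom →* K), Continuous ψ ∧ orderOf (ψ c) = m) :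
    FundamentalExtension.IsFreeProcyclic (C.Icusp x) := by
  have h1 : FundamentalExtension.IsFreeProcyclic (Subgroup.zpowers c).topologicalClosure :=
    isFreeProcyclic_topologicalClosure_zpowers_of_centralImages c hc
  have hI' : C.Icusp x = (Subgroup.zpowers c).topologicalClosure.map E.geom.subtype := by
    rw [hI, ← E.topologicalClosure_map_geomSubtype, MonoidHom.map_zpowers, Subgroup.coe_subtype]
  have hto : ∀ y : (Subgroup.zpowers c).topologicalClosure, ((y : E.geom) : E.arith) ∈ C.Icusp x :=
    fun y => by
      rw [hI']
      exact ⟨y, y.2, rfl⟩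
  have hfrom₁ : ∀ z : C.Icusp x, (z : E.arith) ∈ E.geom := fun z => C.Icusp_le_geom x z.2
  have hfrom₂ : ∀ z : C.Icusp x,
      (⟨z, hfrom₁ z⟩ : E.geom) ∈ (Subgroup.zpowers c).topologicalClosure := by
    intro z
    have hz : (z : E.arith) ∈ (Subgroup.zpowers c).topologicalClosure.map E.geom.subtype := by
      rw [← hI']
      exact z.2
    obtain ⟨y, hy, hyz⟩ := hz
    have hy' : y = ⟨z, hfrom₁ z⟩ := Subtype.ext hyz
    exact hy' ▸ hy
  let e : (Subgroup.zpowers c).topologicalClosure ≃ₜ* C.Icusp x :=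
    { toFun := fun y => ⟨(y : E.geom), hto y⟩
      invFun := fun z => ⟨⟨z, hfrom₁ z⟩, hfrom₂ z⟩
      left_inv := fun _ => rfl
      right_inv := fun _ => rfl
      map_mul' := fun _ _ => rfl
      continuous_toFun := (continuous_subtype_val.comp continuous_subtype_val).subtype_mk hto
      continuous_invFun := (continuous_subtype_val.subtype_mk hfrom₁).subtype_mk hfrom₂ }
  exact h1.of_continuousMulEquiv e

/-- **A cyclotome presentation from the Heisenberg datum.**  At a presentation `(U_x ⊆ X, x)` with
`U_x, X` scheme-like, `X` proper, `x` rational, `N = ⟨⟨I_x⟩⟩⁻` and `I_x = ⟨c⟩⁻` for some `c ∈ Δ_{U_x}` with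
central images of every order in finite continuous quotients of `Δ_{U_x}`, ALL clauses of
`IsCyclotomePresentation` hold: `I_x ≅ Ẑ` (Prop. 1.4 (i)) and `1 → I_x → Δ^{c-cn}_{U_x} → Δ_X → 1` exact
(Prop. 1.4 (ii)) are both CONSEQUENCES of the datum — the hypothesis container of the Thm. 1.9 (b)/(e) and
Prop. 1.6 consumers, inhabited from the classical law at an arbitrary base field.
[cite: MochizukiAbsTopIII2015, Prop 1.4 (ii) p.31] -/
theorem CurveModel.isCyclotomePresentation_of_centralImages (M : CurveModel.{u}) {Ux X : M.Curve}
    (h : M.IsCofiniteOpen Ux X) (x : (M.cusps Ux).Cusp) (hUx : M.IsScheme Ux) (hX : M.IsScheme X)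
    (hXp : M.IsProper X) (hx : (M.cusps Ux).IsRational x)
    (hker : cuspidalKernel (M.res h) =
      (Subgroup.normalClosure ((M.cusps Ux).Icusp x : Set (M.ext Ux).arith)).topologicalClosure)
    (c : (M.ext Ux).geom)
    (hI : (M.cusps Ux).Icusp x = (Subgroup.zpowers (c : (M.ext Ux).arith)).topologicalClosure)
    (hc : ∀ m : ℕ, 0 < m → ∃ (K : Type) (_ : Group K) (_ : Finite K) (_ : TopologicalSpace K)
      (_ : DiscreteTopology K) (ψ : (M.ext Ux).geom →* K),
        Continuous ψ ∧ ψ c ∈ Subgroup.center K ∧ orderOf (ψ c) = m) :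
    M.IsCyclotomePresentation h x where
  isScheme := ⟨hUx, hX⟩
  isProper := hXp
  isRational := hx
  isFreeProcyclic := isFreeProcyclic_Icusp_of_imagesOfEveryOrder (M.cusps Ux) x c hI fun m hm => by
    obtain ⟨K, _, _, _, _, ψ, hψ, -, hord⟩ := hc m hm
    exact ⟨K, inferInstance, inferInstance, inferInstance, inferInstance, ψ, hψ, hord⟩
  kernel_eq := hker
  isCuspidallyCentral :=
    isCuspidallyCentralExtension_of_centralImages (M.res h) (M.cusps Ux) x hx hker c hI hc

/-- **A cyclotome presentation from the surface presentation** (`g_X ≥ 1`): `Δ_{U_x}` free profinite on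
`a_i, b_i` (`i < g_X`) with `I_x = ⟨∏[a_i, b_i]⟩⁻`, `x` rational, `N = ⟨⟨I_x⟩⟩⁻`, `X` proper ⇒
`IsCyclotomePresentation`. [cite: MochizukiAbsTopIII2015, Prop 1.4 (ii) p.31] -/
theorem CurveModel.isCyclotomePresentation_of_surfacePresentation (M : CurveModel.{u})
    {Ux X : M.Curve} (h : M.IsCofiniteOpen Ux X) (x : (M.cusps Ux).Cusp) (hUx : M.IsScheme Ux)
    (hX : M.IsScheme X) (hXp : M.IsProper X) (hx : (M.cusps Ux).IsRational x)
    (hker : cuspidalKernel (M.res h) =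
      (Subgroup.normalClosure ((M.cusps Ux).Icusp x : Set (M.ext Ux).arith)).topologicalClosure)
    (hpos : 0 < M.genus X) (gens : Fin (M.genus X + M.genus X) → (M.ext Ux).geom)
    (hP : IsFreeProOn (M.ext Ux).geom {p : ℕ | p.Prime} gens)
    (hI : (M.cusps Ux).Icusp x =
      (Subgroup.zpowers ((((List.finRange (M.genus X)).map fun i =>
        gens (Fin.castAdd (M.genus X) i) * gens (Fin.natAdd (M.genus X) i) *
          (gens (Fin.castAdd (M.genus X) i))⁻¹ * (gens (Fin.natAdd (M.genus X) i))⁻¹).prod :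
            (M.ext Ux).geom) : (M.ext Ux).arith)).topologicalClosure) :
    M.IsCyclotomePresentation h x :=
  M.isCyclotomePresentation_of_centralImages h x hUx hX hXp hx hker _ hI
    (hP.centralImages_surfaceRelator (fun _ hp => hp) hpos)

end AbsTopIII

end Literature.AnabelianGeometry.AbsoluteAnabelian
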